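import Summits.AtomisticToContinuum.HydrodynamicLimit.Theorems.AntiMazurCoboundariesTransferSkeletonTools
import Summits.AtomisticToContinuum.HydrodynamicLimit.Theorems.AntiMazurCoboundariesErrorCorrectorPressure
import Summits.AtomisticToContinuum.HydrodynamicLimit.Theorems.AntiMazurCoboundariesLocalCertificateTransfer
import Literature.Analysis.FluidPDE.HardSphereAlexander

/-!
# The local-certificate transfer skeleton: `CorrectorPressureDecay` from three typed inputs

Route `AntiMazurCoboundaries` of `AtomisticToContinuum/HydrodynamicLimit`, support item
stmt-AtomisticToContinuum-13917 (`LocalCertificateTransfer : InfluenceLocality → CellForecastPressureDecay →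
CorrectorPressureDecay`). This file (`--supports`) carries out ALL the soft analysis of the transfer plan
(steps (1)–(4) and (8)) and isolates what remains as explicit hypotheses:

* `TransferSkeleton.lintegral_exp_defect_le` — LAYER 1: for one flow, one law preserved by it and carried by
  the good set, and one bounded one-body observable, the defect pressure (amplitude `2`) of the Fejér LOCAL
  FORECAST corrector `W = localForecastCorrector Ψ R H f` at lag `s` is bounded by a common bound `c` of
  four pressures: within-lag shot noise (amplitude `6`), forecast window (amplitude `12`), and the bad count
  at `lam = 24C` and `lam = 12HC/s`. Ingredients: `W = W^{true} + E` on the good set, the Fejér defect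
  identity (`FejerDefect.defect_identity`), AM–GM in three groups, the lag-average bound
  (`FejerDefect.lintegral_exp_lagAverage_window_le`), the window comparison on bad particles, and the
  error-quotient pressure bound (`ForecastError.lintegral_exp_errorQuotient_le`).
* `TransferSkeleton.correctorPressureDecay_of_inputs` — LAYER 2 (quantifier assembly): the crux
  `CorrectorPressureDecay` follows from (h₁) finite speed of influence in its EVENTUAL-in-`R` form
  (`∃ R₀ ∀ R ≥ R₀`), (h₂) a within-lag shot-noise pressure bound for the true flow (plan step (5)), and
  (h₃) a forecast-window pressure bound under `G_N` (plan steps (6)–(7), to be fed by the N-free core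
  `CellForecastPressureDecay`). The typed crux `InfluenceLocality` (stmt-13916) provides only `∃ R`, which is
  why the glue as filed cannot be closed from it (see the evidence note on stmt-13917); with (h₁) the order of
  choices `δ → T → s → lam → R → N₀` closes.

References: Kipnis–Landim (1999) Ch. 7 §2–3; route docstring of stmt-AtomisticToContinuum-13917.
-/

noncomputable section

open MeasureTheory Set Filter Topology

namespace Summit.AtomisticToContinuum.HydrodynamicLimit.Theorems

open Literature.Analysis.FluidPDE
open Literature.MathematicalPhysics.KineticTheory (T3 V3 hsDiameter localGibbsLaw hsDiameter_pos hsDiameter_le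
  isProbabilityMeasure_localGibbsLaw)

namespace TransferSkeleton

open BoltzmannGreenKuboOrthMomentum (flowMod flowMod_of_mem measurable_flowMod)

variable {N : ℕ} {ε : ℝ}

open scoped Classical in
/-- **LAYER 1 OF THE TRANSFER — the defect of the Fejér local forecast corrector from four pressures.**
Fix a hard-sphere flow `Φ` on `𝕋³`, cluster flows `Ψ`, a probability law `μ` preserved by the flow and
carried by the good set, a measurable one-body observable `f` with `|f| ≤ C`, a horizon `H > 0`, a lag
`s > 0` and a range `R`. If a common bound `c` controls
(S) the within-lag SHOT-NOISE pressure at amplitude `6`,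
(W) the FORECAST WINDOW pressure at amplitude `12`,
(L₁) the bad-count pressure at `lam = 24C` and (L₂) at `lam = 12HC/s`,
then the defect pressure of `W = localForecastCorrector Ψ R H f` at lag `s` and amplitude `2` is at most
`c`: `∫ exp(2(F − s⁻¹(W∘Φ_s − W))) dμ ≤ c`, `F(z) = Σᵢ f(zᵢ)`.
Proof: `W = W^{true} + E` on the good set; the Fejér defect identity `F − D_{W^{true}} = S + B`
(`FejerDefect.defect_identity`); AM–GM in three groups; `B` costs at most the true window pressure
(`FejerDefect.lintegral_exp_lagAverage_window_le`), which differs from the forecast window pressure by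
`2C·#bad` per unit amplitude (midpoint convexity + (L₁)); the error quotient is carried by the bad
particles (`ForecastError.lintegral_exp_errorQuotient_le` + (L₂)). [folklore] -/
theorem lintegral_exp_defect_le (Φ : HardSphereFlow (Torus.geometry (Fin 3)) ε N)
    (Ψ : (k : ℕ) → HardSphereFlow (Torus.geometry (Fin 3)) ε k)
    (μ : Measure (Config N (Fin 3) T3)) [IsProbabilityMeasure μ]
    (hinv : ∀ t, MeasurePreserving (Φ.flow t) μ μ) (hgood : μ Φ.goodᶜ = 0)
    {f : T3 × EuclideanSpace ℝ (Fin 3) → ℝ} (hfm : Measurable f) {C : ℝ} (hf : ∀ q, |f q| ≤ C)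
    {H s : ℝ} (hH : 0 < H) (hs : 0 < s) (R : ℝ) (c : ENNReal)
    (bS : ∫⁻ z, ENNReal.ofReal (Real.exp (6 * ((∑ i, f (z i)) -
      s⁻¹ * ∫ u in (0 : ℝ)..s, ∑ i, f (Φ.flow u z i)))) ∂μ ≤ c)
    (bW : ∫⁻ z, ENNReal.ofReal (Real.exp (12 * ∑ i, H⁻¹ * ∫ t in (0 : ℝ)..H,
      f (localClusterState Ψ R t z i))) ∂μ ≤ c)
    (bL₁ : ∫⁻ z, ENNReal.ofReal (Real.exp (24 * C * ((Finset.univ.filter fun i : Fin N =>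
      ∃ t ∈ Set.Icc (0 : ℝ) H, Φ.flow t z i ≠ localClusterState Ψ R t z i).card : ℝ))) ∂μ ≤ c)
    (bL₂ : ∫⁻ z, ENNReal.ofReal (Real.exp (2 * (6 * (H * C / s)) * ((Finset.univ.filter fun i : Fin N =>
      ∃ t ∈ Set.Icc (0 : ℝ) H, Φ.flow t z i ≠ localClusterState Ψ R t z i).card : ℝ))) ∂μ ≤ c) :
    ∫⁻ z, ENNReal.ofReal (Real.exp (2 * ((∑ i, f (z i)) -
      s⁻¹ * (localForecastCorrector Ψ R H f (Φ.flow s z) - localForecastCorrector Ψ R H f z)))) ∂μ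
      ≤ c := by
  classical
  have hae : ∀ᵐ z ∂μ, z ∈ Φ.good := mem_ae_iff.2 hgood
  -- the one-body sum observable
  have hFm : Measurable fun z : Config N (Fin 3) T3 => ∑ i, f (z i) :=
    Finset.measurable_sum _ fun i _ => hfm.comp (measurable_pi_apply i)
  have hFb : ∀ z : Config N (Fin 3) T3, |∑ i, f (z i)| ≤ ∑ _i : Fin N, C := fun z =>
    (Finset.abs_sum_le_sum_abs _ _).trans (Finset.sum_le_sum fun i _ => hf _)
  -- names for the pieces (all with the TRUE flow; only evaluated on good points)
  set n : Config N (Fin 3) T3 → ℝ := fun z => ((Finset.univ.filter fun i : Fin N =>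
    ∃ t ∈ Set.Icc (0 : ℝ) H, Φ.flow t z i ≠ localClusterState Ψ R t z i).card : ℝ) with hn
  set Wt : Config N (Fin 3) T3 → ℝ := fun x =>
    -∫ t in (0 : ℝ)..H, (1 - t / H) * ∑ i, f (Φ.flow t x i) with hWt
  set E : Config N (Fin 3) T3 → ℝ := fun x => localForecastCorrector Ψ R H f x -
    (-∑ i, ∫ t in (0 : ℝ)..H, (1 - t / H) * f (Φ.flow t x i)) with hE
  set S : Config N (Fin 3) T3 → ℝ := fun z => (∑ i, f (z i)) -
    s⁻¹ * ∫ u in (0 : ℝ)..s, ∑ i, f (Φ.flow u z i) with hS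
  set B : Config N (Fin 3) T3 → ℝ := fun z =>
    s⁻¹ * ∫ u in (0 : ℝ)..s, H⁻¹ * ∫ t in u..(u + H), ∑ i, f (Φ.flow t z i) with hB
  set D : Config N (Fin 3) T3 → ℝ := fun z => s⁻¹ * (E (Φ.flow s z) - E z) with hD
  set Wfc : Config N (Fin 3) T3 → ℝ := fun z =>
    ∑ i, H⁻¹ * ∫ t in (0 : ℝ)..H, f (localClusterState Ψ R t z i) with hWfc
  -- (A) on the good set `W_loc = Wt + E`
  have hsplit : ∀ x ∈ Φ.good, localForecastCorrector Ψ R H f x = Wt x + E x := by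
    intro x hx
    have hswap := intervalIntegral_weight_mul_sum (fun t => Φ.flow t x)
      (AntiMazurCertificate.measurable_flow_orbit Φ hx) hfm hf
      (w := fun t => 1 - t / H) (by fun_prop) 0 H
    simp only [hWt, hE, hswap]
    ring
  -- (A') the pointwise defect identity on the good set
  have hpt : ∀ z ∈ Φ.good, (∑ i, f (z i)) -
      s⁻¹ * (localForecastCorrector Ψ R H f (Φ.flow s z) - localForecastCorrector Ψ R H f z) =
      S z + B z - D z := by
    intro z hz
    have hzs : Φ.flow s z ∈ Φ.good := Φ.mapsTo_good s hz
    have hid := FejerDefect.defect_identity Φ hz hFm hFb hH Wt (fun x => rfl) s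
    rw [hsplit _ hzs, hsplit _ hz]
    simp only [hS, hB, hD]
    rw [← hid]
    ring
  -- (B) AM–GM in three groups, pointwise on the good set
  have ham : ∀ z ∈ Φ.good, ENNReal.ofReal (Real.exp (2 * ((∑ i, f (z i)) -
      s⁻¹ * (localForecastCorrector Ψ R H f (Φ.flow s z) - localForecastCorrector Ψ R H f z)))) ≤
      ENNReal.ofReal 3⁻¹ * (ENNReal.ofReal (Real.exp (6 * S z)) + ENNReal.ofReal (Real.exp (6 * B z)) +
        ENNReal.ofReal (Real.exp (6 * |D z|))) := by
    intro z hz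
    rw [hpt z hz, ← ENNReal.ofReal_add (Real.exp_pos _).le (Real.exp_pos _).le,
      ← ENNReal.ofReal_add (by positivity) (Real.exp_pos _).le, ← ENNReal.ofReal_mul (by norm_num)]
    refine ENNReal.ofReal_le_ofReal ?_
    have h1 : Real.exp (2 * (S z + B z - D z)) ≤ Real.exp (2 * S z + 2 * B z + 2 * |D z|) :=
      Real.exp_le_exp.2 (by linarith [neg_abs_le (D z)])
    have h2 := exp_add_three_le (2 * S z) (2 * B z) (2 * |D z|)
    have h3 : ∀ w : ℝ, 3 * (2 * w) = 6 * w := fun w => by ring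
    rw [h3, h3, h3] at h2
    linarith
  -- (C) measurability of the first two groups
  have hSm : AEMeasurable (fun z => ENNReal.ofReal (Real.exp (6 * S z))) μ :=
    (Real.measurable_exp.comp_aemeasurable
      ((aemeasurable_shotNoise Φ hFm s μ hgood).const_mul 6)).ennreal_ofReal
  have hBm : AEMeasurable (fun z => ENNReal.ofReal (Real.exp (6 * B z))) μ :=
    (Real.measurable_exp.comp_aemeasurable
      ((aemeasurable_lagAverageWindow Φ hFm hFb s H μ hgood).const_mul 6)).ennreal_ofReal
  -- (D) the three group bounds
  have gS : ∫⁻ z, ENNReal.ofReal (Real.exp (6 * S z)) ∂μ ≤ c := bS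
  have gB : ∫⁻ z, ENNReal.ofReal (Real.exp (6 * B z)) ∂μ ≤ c := by
    -- lag-average ≤ true window
    have h1 : ∫⁻ z, ENNReal.ofReal (Real.exp (6 * B z)) ∂μ ≤
        ∫⁻ z, ENNReal.ofReal (Real.exp (6 * (H⁻¹ * ∫ t in (0 : ℝ)..H, ∑ i, f (Φ.flow t z i)))) ∂μ :=
      FejerDefect.lintegral_exp_lagAverage_window_le Φ μ hinv hgood hFm hFb 6 hH hs
    -- true window ≤ forecast window + 2C #bad, then midpoint convexity
    have h2 : ∀ z ∈ Φ.good, ENNReal.ofReal (Real.exp (6 * (H⁻¹ * ∫ t in (0 : ℝ)..H, ∑ i, f (Φ.flow t z i)))) ≤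
        ENNReal.ofReal 2⁻¹ * (ENNReal.ofReal (Real.exp (12 * Wfc z)) +
          ENNReal.ofReal (Real.exp (24 * C * n z))) := by
      intro z hz
      have hswap : H⁻¹ * ∫ t in (0 : ℝ)..H, ∑ i, f (Φ.flow t z i) =
          ∑ i, H⁻¹ * ∫ t in (0 : ℝ)..H, f (Φ.flow t z i) := by
        rw [intervalIntegral_sum (fun t => Φ.flow t z) (AntiMazurCertificate.measurable_flow_orbit Φ hz)
          hfm hf, Finset.mul_sum]
      have hdiff := abs_window_true_sub_forecast_le Ψ Φ.flow R hH hf z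
      have hle : (∑ i, H⁻¹ * ∫ t in (0 : ℝ)..H, f (Φ.flow t z i)) ≤ Wfc z + 2 * C * n z := by
        have := (abs_sub_le_iff.1 hdiff).1
        simp only [hWfc, hn]
        linarith
      rw [hswap, ← ENNReal.ofReal_add (Real.exp_pos _).le (Real.exp_pos _).le,
        ← ENNReal.ofReal_mul (by norm_num)]
      refine ENNReal.ofReal_le_ofReal ?_
      have hmid := AntiMazurCertificate.exp_half_add_le (12 * Wfc z) (24 * C * n z)
      have hmono : Real.exp (6 * ∑ i, H⁻¹ * ∫ t in (0 : ℝ)..H, f (Φ.flow t z i)) ≤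
          Real.exp (2⁻¹ * (12 * Wfc z + 24 * C * n z)) :=
        Real.exp_le_exp.2 (by linarith)
      exact hmono.trans hmid
    have hWm : AEMeasurable (fun z => ENNReal.ofReal (Real.exp (12 * Wfc z))) μ :=
      (Real.measurable_exp.comp ((measurable_forecastWindow Ψ R H hfm).const_mul 12)).ennreal_ofReal
        |>.aemeasurable
    calc ∫⁻ z, ENNReal.ofReal (Real.exp (6 * B z)) ∂μ
        ≤ ∫⁻ z, ENNReal.ofReal (Real.exp (6 * (H⁻¹ * ∫ t in (0 : ℝ)..H, ∑ i, f (Φ.flow t z i)))) ∂μ := h1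
      _ ≤ ∫⁻ z, ENNReal.ofReal 2⁻¹ * (ENNReal.ofReal (Real.exp (12 * Wfc z)) +
          ENNReal.ofReal (Real.exp (24 * C * n z))) ∂μ := lintegral_mono_ae (hae.mono h2)
      _ = ENNReal.ofReal 2⁻¹ * ((∫⁻ z, ENNReal.ofReal (Real.exp (12 * Wfc z)) ∂μ) +
          ∫⁻ z, ENNReal.ofReal (Real.exp (24 * C * n z)) ∂μ) := by
          rw [lintegral_const_mul' _ _ ENNReal.ofReal_ne_top, lintegral_add_left' hWm]
      _ ≤ ENNReal.ofReal 2⁻¹ * (c + c) := by gcongr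
      _ = c := ofReal_half_mul_two c
  have gD : ∫⁻ z, ENNReal.ofReal (Real.exp (6 * |D z|)) ∂μ ≤ c :=
    (ForecastError.lintegral_exp_errorQuotient_le Φ Ψ R hH.le hf hs E (fun x => rfl) μ hinv hgood
      (a := 6) (by norm_num)).trans bL₂
  -- (E) assemble
  calc ∫⁻ z, ENNReal.ofReal (Real.exp (2 * ((∑ i, f (z i)) -
        s⁻¹ * (localForecastCorrector Ψ R H f (Φ.flow s z) - localForecastCorrector Ψ R H f z)))) ∂μ
      ≤ ∫⁻ z, ENNReal.ofReal 3⁻¹ * (ENNReal.ofReal (Real.exp (6 * S z)) +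
          ENNReal.ofReal (Real.exp (6 * B z)) + ENNReal.ofReal (Real.exp (6 * |D z|))) ∂μ :=
        lintegral_mono_ae (hae.mono ham)
    _ = ENNReal.ofReal 3⁻¹ * ((∫⁻ z, ENNReal.ofReal (Real.exp (6 * S z)) ∂μ) +
          (∫⁻ z, ENNReal.ofReal (Real.exp (6 * B z)) ∂μ) + ∫⁻ z, ENNReal.ofReal (Real.exp (6 * |D z|)) ∂μ) := by
        have hSBm : AEMeasurable (fun z => ENNReal.ofReal (Real.exp (6 * S z)) +
            ENNReal.ofReal (Real.exp (6 * B z))) μ := hSm.add hBm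
        rw [lintegral_const_mul' _ _ ENNReal.ofReal_ne_top, lintegral_add_left' hSBm,
          lintegral_add_left' hSm]
    _ ≤ ENNReal.ofReal 3⁻¹ * (c + c + c) := by gcongr
    _ = c := ofReal_third_mul_three c


/-! ## Layer 2 — the quantifier assembly (the repaired `LocalCertificateTransfer`, modulo two inputs) -/

open scoped Classical in
/-- **THE LOCAL-CERTIFICATE TRANSFER, REPAIRED SHAPE, MODULO ITS TWO ANALYTIC INPUTS.**
`CorrectorPressureDecay` follows from
(h₁) finite speed of influence in its EVENTUAL-in-`R` form (`∃ R₀ ∀ R ≥ R₀`; the typed crux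
  `InfluenceLocality` = stmt-13916 only gives `∃ R`, which cannot be aligned with the core's threshold —
  see the evidence note of stmt-13917),
(h₂) the WITHIN-LAG SHOT-NOISE pressure of the true flow (plan step (5)): for every bounded one-body
  observable, every amplitude `A` and tolerance `ψ`, SOME kinetic lag `s ≤ s₁` makes the pressure of
  `A·(F − (sℓ)⁻¹∫₀^{sℓ} F∘Φ_u du)` at most `ψ(N+1)` for all large `N`,
(h₃) the FORECAST-WINDOW pressure (plan steps (6)–(7) fed by the N-free core `CellForecastPressureDecay`):
  at some amplitude `κ`, window-`Tℓ` averages of the observable along range-`Rℓ` LOCAL FORECASTS have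
  pressure `≤ δ(N+1)` under `G_N` once `T ≥ T(δ)`, `R ≥ R₀(T)`, `N ≥ N₀(R)`.
Order of choices: `δ → T, R₀ʷ (h₃ at g ↦ 12g) → s ≤ T (h₂ at A = 6) → lam = max(24κ, 12Tκ/s) →
R = max(R₀ʷ, R₀ᴸ(T, lam, δ)) (h₁) → N₀`; then Layer 1 (`lintegral_exp_defect_le`) with
`c = e^{δ(N+1)}` and the packaging `correctorPressureDecay_of_localForecastDefect`. [folklore] -/
theorem correctorPressureDecay_of_inputs
    (h₁ : ∀ (a θ : ℝ) (u₀ : V3), 0 < a → 0 < θ → ∃ σ₀ : ℝ, 0 < σ₀ ∧ ∀ σ : ℝ, 0 < σ → σ < σ₀ →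
      ∀ (T lam δ : ℝ), 0 < T → 0 < lam → 0 < δ → ∃ R₀ : ℝ, 0 < R₀ ∧ ∀ R : ℝ, R₀ ≤ R →
      ∃ N₀ : ℕ, ∀ N : ℕ, N₀ ≤ N →
      ∀ (Φ : HardSphereFlow (Torus.geometry (Fin 3)) (hsDiameter σ N) (N + 1))
        (Ψ : (k : ℕ) → HardSphereFlow (Torus.geometry (Fin 3)) (hsDiameter σ N) k),
      ∫⁻ z, ENNReal.ofReal (Real.exp (lam * ((Finset.univ.filter fun i : Fin (N + 1) =>
          ∃ t ∈ Set.Icc (0 : ℝ) (T * ((N + 1 : ℕ) : ℝ) ^ (-(1 / 3 : ℝ))),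
            Φ.flow t z i ≠ localClusterState Ψ (R * ((N + 1 : ℕ) : ℝ) ^ (-(1 / 3 : ℝ))) t z i).card : ℝ)))
        ∂(localGibbsLaw σ (fun _ => a) (fun _ => u₀) (fun _ => θ) N Φ)
      ≤ ENNReal.ofReal (Real.exp (δ * (N + 1))))
    (h₂ : ∀ (a θ : ℝ) (u₀ : V3), 0 < a → 0 < θ → ∃ σ₀ : ℝ, 0 < σ₀ ∧ ∀ σ : ℝ, 0 < σ → σ < σ₀ →
      ∀ (φ : T3 → ℝ) (g : V3 → ℝ) (K A ψ s₁ : ℝ), Continuous φ → Continuous g → (∀ x, |φ x| ≤ 1) →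
      (∀ v, |g v| ≤ K) → 0 < A → 0 < ψ → 0 < s₁ →
      ∃ s : ℝ, 0 < s ∧ s ≤ s₁ ∧ ∃ N₀ : ℕ, ∀ N : ℕ, N₀ ≤ N →
      ∀ Φ : HardSphereFlow (Torus.geometry (Fin 3)) (hsDiameter σ N) (N + 1),
      ∫⁻ z, ENNReal.ofReal (Real.exp (A * ((∑ i, φ (z i).1 * g ((Real.sqrt θ)⁻¹ • ((z i).2 - u₀))) -
          (s * ((N + 1 : ℕ) : ℝ) ^ (-(1 / 3 : ℝ)))⁻¹ *
            ∫ u in (0 : ℝ)..(s * ((N + 1 : ℕ) : ℝ) ^ (-(1 / 3 : ℝ))),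
              ∑ i, φ (Φ.flow u z i).1 * g ((Real.sqrt θ)⁻¹ • ((Φ.flow u z i).2 - u₀)))))
        ∂(localGibbsLaw σ (fun _ => a) (fun _ => u₀) (fun _ => θ) N Φ)
      ≤ ENNReal.ofReal (Real.exp (ψ * (N + 1))))
    (h₃ : ∀ (a θ : ℝ) (u₀ : V3), 0 < a → 0 < θ → ∃ σ₀ : ℝ, 0 < σ₀ ∧ ∀ σ : ℝ, 0 < σ → σ < σ₀ →
      ∃ κ : ℝ, 0 < κ ∧ ∀ (φ : T3 → ℝ) (g : V3 → ℝ), Continuous φ → Continuous g → (∀ x, |φ x| ≤ 1) →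
      (∀ v, |g v| ≤ κ) →
      (∀ (c₀ c₂ : ℝ) (b : V3),
        ∫ v, g v * (c₀ + inner ℝ b v + c₂ * ‖v‖ ^ 2) ∂(ProbabilityTheory.stdGaussian V3) = 0) →
      ∀ δ : ℝ, 0 < δ → ∃ T : ℝ, 0 < T ∧ ∃ R₀ : ℝ, 0 < R₀ ∧ ∀ R : ℝ, R₀ ≤ R → ∃ N₀ : ℕ, ∀ N : ℕ, N₀ ≤ N →
      ∀ (Φ : HardSphereFlow (Torus.geometry (Fin 3)) (hsDiameter σ N) (N + 1))
        (Ψ : (k : ℕ) → HardSphereFlow (Torus.geometry (Fin 3)) (hsDiameter σ N) k),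
      ∫⁻ z, ENNReal.ofReal (Real.exp (∑ i, (T * ((N + 1 : ℕ) : ℝ) ^ (-(1 / 3 : ℝ)))⁻¹ *
          ∫ t in (0 : ℝ)..(T * ((N + 1 : ℕ) : ℝ) ^ (-(1 / 3 : ℝ))),
            φ (localClusterState Ψ (R * ((N + 1 : ℕ) : ℝ) ^ (-(1 / 3 : ℝ))) t z i).1 *
              g ((Real.sqrt θ)⁻¹ • ((localClusterState Ψ (R * ((N + 1 : ℕ) : ℝ) ^ (-(1 / 3 : ℝ))) t z i).2 - u₀))))
        ∂(localGibbsLaw σ (fun _ => a) (fun _ => u₀) (fun _ => θ) N Φ)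
      ≤ ENNReal.ofReal (Real.exp (δ * (N + 1)))) :
    Summit.AtomisticToContinuum.HydrodynamicLimit.Theses.AntiMazurCoboundaries.CorrectorPressureDecay := by
  classical
  refine LocalCertificateTransfer.correctorPressureDecay_of_localForecastDefect fun a θ u₀ ha hθ => ?_
  obtain ⟨σ₁, hσ₁, H₁⟩ := h₁ a θ u₀ ha hθ
  obtain ⟨σ₂, hσ₂, H₂⟩ := h₂ a θ u₀ ha hθ
  obtain ⟨σ₃, hσ₃, H₃⟩ := h₃ a θ u₀ ha hθ
  refine ⟨min (min σ₁ σ₂) (min σ₃ (1 / 2)), by positivity, (min_le_right _ _).trans (min_le_right _ _),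
    fun σ hσ hσlt => ?_⟩
  have hσ1 : σ < σ₁ := hσlt.trans_le ((min_le_left _ _).trans (min_le_left _ _))
  have hσ2 : σ < σ₂ := hσlt.trans_le ((min_le_left _ _).trans (min_le_right _ _))
  have hσ3 : σ < σ₃ := hσlt.trans_le ((min_le_right _ _).trans (min_le_left _ _))
  have hσhalf : σ < 1 / 2 := hσlt.trans_le ((min_le_right _ _).trans (min_le_right _ _))
  obtain ⟨κW, hκW, HW⟩ := H₃ σ hσ hσ3
  refine ⟨κW / 12, by positivity, fun φ g hφ hg hφ1 hgκ horth δ hδ => ?_⟩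
  -- (h₃) at `g' = 12 g`
  have hg' : Continuous fun v : V3 => 12 * g v := continuous_const.mul hg
  have hg'κ : ∀ v, |12 * g v| ≤ κW := fun v => by
    rw [abs_mul, abs_of_pos (by norm_num : (0 : ℝ) < 12)]
    linarith [hgκ v]
  have horth' : ∀ (c₀ c₂ : ℝ) (b : V3),
      ∫ v, 12 * g v * (c₀ + inner ℝ b v + c₂ * ‖v‖ ^ 2) ∂(ProbabilityTheory.stdGaussian V3) = 0 := by
    intro c₀ c₂ b
    have : (fun v : V3 => 12 * g v * (c₀ + inner ℝ b v + c₂ * ‖v‖ ^ 2)) =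
        fun v => 12 * (g v * (c₀ + inner ℝ b v + c₂ * ‖v‖ ^ 2)) := by
      funext v; ring
    rw [this, integral_const_mul, horth c₀ c₂ b, mul_zero]
  obtain ⟨T, hT, R₀W, hR₀W, HW'⟩ := HW φ (fun v => 12 * g v) hφ hg' hφ1 hg'κ horth' δ hδ
  -- (h₂) at amplitude 6, tolerance δ, lag ≤ T
  obtain ⟨s, hs, hsT, N₂, HS⟩ := H₂ σ hσ hσ2 φ g (κW / 12) 6 δ T hφ hg hφ1 hgκ (by norm_num) hδ hT
  -- (h₁) at horizon T, amplitude lam, tolerance δ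
  set lam : ℝ := max (24 * (κW / 12)) (12 * T * (κW / 12) / s) with hlam
  have hlam_pos : 0 < lam := lt_max_of_lt_left (by positivity)
  obtain ⟨R₀L, hR₀L, HL⟩ := H₁ σ hσ hσ1 T lam δ hT hlam_pos hδ
  set R : ℝ := max R₀W R₀L with hR
  obtain ⟨N₃, HW''⟩ := HW' R (le_max_left _ _)
  obtain ⟨N₁, HL'⟩ := HL R (le_max_right _ _)
  refine ⟨T, hT, s, hs, R, max (max N₁ N₂) N₃, fun N hN Φ => ?_⟩
  have hN1 : N₁ ≤ N := ((le_max_left _ _).trans (le_max_left _ _)).trans hN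
  have hN2 : N₂ ≤ N := ((le_max_right _ _).trans (le_max_left _ _)).trans hN
  have hN3 : N₃ ≤ N := (le_max_right _ _).trans hN
  -- microscopic scales and the cluster flows (Alexander's theorem on the torus)
  set ℓ : ℝ := ((N + 1 : ℕ) : ℝ) ^ (-(1 / 3 : ℝ)) with hℓ
  have hℓpos : 0 < ℓ := Real.rpow_pos_of_pos (Nat.cast_pos.mpr (Nat.succ_pos N)) _
  have hεpos : 0 < hsDiameter σ N := hsDiameter_pos hσ N
  have hεhalf : hsDiameter σ N < 2⁻¹ :=
    (hsDiameter_le hσ.le N).trans_lt (by rw [inv_eq_one_div]; exact hσhalf)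
  set Ψ : (k : ℕ) → HardSphereFlow (Torus.geometry (Fin 3)) (hsDiameter σ N) k := fun k =>
    (HardSphereFlow.nonempty_torus_holds (d := Fin 3) hεpos hεhalf k).some with hΨ
  refine ⟨Ψ, ?_⟩
  -- the Gibbs law: probability, invariant, carried by the good set
  set μ := localGibbsLaw σ (fun _ => a) (fun _ => u₀) (fun _ => θ) N Φ with hμ
  haveI : IsProbabilityMeasure μ := isProbabilityMeasure_localGibbsLaw continuous_const continuous_const
    continuous_const (fun _ => ha) (fun _ => hθ) (hσhalf.le.trans (by norm_num)) N Φ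
  have hinv : ∀ t, MeasurePreserving (Φ.flow t) μ μ := fun t =>
    measurePreserving_flow_localGibbsLaw_const σ a θ u₀ N Φ t
  have hgood : μ Φ.goodᶜ = 0 := by
    have hac : μ ≪ liouville (Torus.geometry (Fin 3)) (N + 1) (hsDiameter σ N) := by
      simp only [hμ, localGibbsLaw, particleLaw_eq]
      exact withDensity_absolutelyContinuous _ _
    exact hac Φ.measure_compl_good
  -- the one-body observable
  set f : T3 × EuclideanSpace ℝ (Fin 3) → ℝ := fun q => φ q.1 * g ((Real.sqrt θ)⁻¹ • (q.2 - u₀)) with hfdef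
  have hfm : Measurable f := by
    have hc : Continuous f := by simp only [hfdef]; fun_prop
    exact hc.measurable
  have hfκ : ∀ q, |f q| ≤ κW / 12 := fun q => by
    simp only [hfdef]
    rw [abs_mul]
    calc |φ q.1| * |g ((Real.sqrt θ)⁻¹ • (q.2 - u₀))| ≤ 1 * (κW / 12) :=
          mul_le_mul (hφ1 _) (hgκ _) (abs_nonneg _) zero_le_one
      _ = κW / 12 := one_mul _
  -- the four pressures
  set c : ENNReal := ENNReal.ofReal (Real.exp (δ * (N + 1))) with hc
  have bS := HS N hN2 Φ
  have bW : ∫⁻ z, ENNReal.ofReal (Real.exp (12 * ∑ i, (T * ℓ)⁻¹ * ∫ t in (0 : ℝ)..(T * ℓ),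
      f (localClusterState Ψ (R * ℓ) t z i))) ∂μ ≤ c := by
    have h := HW'' N hN3 Φ Ψ
    have key : ∀ z : Config (N + 1) (Fin 3) T3,
        (∑ i, (T * ℓ)⁻¹ * ∫ t in (0 : ℝ)..(T * ℓ),
          φ (localClusterState Ψ (R * ℓ) t z i).1 *
            (fun v : V3 => 12 * g v) ((Real.sqrt θ)⁻¹ • ((localClusterState Ψ (R * ℓ) t z i).2 - u₀))) =
        12 * ∑ i, (T * ℓ)⁻¹ * ∫ t in (0 : ℝ)..(T * ℓ), f (localClusterState Ψ (R * ℓ) t z i) := by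
      intro z
      rw [Finset.mul_sum]
      refine Finset.sum_congr rfl fun i _ => ?_
      have : ∫ t in (0 : ℝ)..(T * ℓ), φ (localClusterState Ψ (R * ℓ) t z i).1 *
            (fun v : V3 => 12 * g v) ((Real.sqrt θ)⁻¹ • ((localClusterState Ψ (R * ℓ) t z i).2 - u₀)) =
          12 * ∫ t in (0 : ℝ)..(T * ℓ), f (localClusterState Ψ (R * ℓ) t z i) := by
        rw [← intervalIntegral.integral_const_mul]
        refine intervalIntegral.integral_congr fun t _ => ?_
        simp only [hfdef]
        ring
      rw [this]
      ring
    calc ∫⁻ z, ENNReal.ofReal (Real.exp (12 * ∑ i, (T * ℓ)⁻¹ * ∫ t in (0 : ℝ)..(T * ℓ),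
          f (localClusterState Ψ (R * ℓ) t z i))) ∂μ
        = ∫⁻ z, ENNReal.ofReal (Real.exp (∑ i, (T * ℓ)⁻¹ * ∫ t in (0 : ℝ)..(T * ℓ),
          φ (localClusterState Ψ (R * ℓ) t z i).1 *
            (fun v : V3 => 12 * g v) ((Real.sqrt θ)⁻¹ • ((localClusterState Ψ (R * ℓ) t z i).2 - u₀)))) ∂μ :=
          lintegral_congr fun z => by rw [key z]
      _ ≤ c := h
  have hmonoL : ∀ lam' : ℝ, lam' ≤ lam →
      ∫⁻ z, ENNReal.ofReal (Real.exp (lam' * ((Finset.univ.filter fun i : Fin (N + 1) =>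
        ∃ t ∈ Set.Icc (0 : ℝ) (T * ℓ), Φ.flow t z i ≠ localClusterState Ψ (R * ℓ) t z i).card : ℝ))) ∂μ ≤ c := by
    intro lam' hlam'
    refine le_trans (lintegral_mono fun z => ENNReal.ofReal_le_ofReal (Real.exp_le_exp.2
      (mul_le_mul_of_nonneg_right hlam' (Nat.cast_nonneg _)))) ?_
    exact HL' N hN1 Φ Ψ
  have bL₁ := hmonoL (24 * (κW / 12)) (le_max_left _ _)
  have bL₂ : ∫⁻ z, ENNReal.ofReal (Real.exp (2 * (6 * (T * ℓ * (κW / 12) / (s * ℓ))) *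
      ((Finset.univ.filter fun i : Fin (N + 1) =>
        ∃ t ∈ Set.Icc (0 : ℝ) (T * ℓ), Φ.flow t z i ≠ localClusterState Ψ (R * ℓ) t z i).card : ℝ))) ∂μ ≤ c := by
    refine hmonoL _ (le_of_eq_of_le ?_ (le_max_right _ _))
    field_simp
    norm_num
  -- Layer 1
  have hmain := lintegral_exp_defect_le Φ Ψ μ hinv hgood hfm hfκ (mul_pos hT hℓpos) (mul_pos hs hℓpos)
    (R * ℓ) c bS bW bL₁ bL₂
  simpa only [hfdef] using hmain

end TransferSkeleton

end Summit.AtomisticToContinuum.HydrodynamicLimit.Theorems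

end
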